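import Mathlib.Combinatorics.Additive.AP.Three.Behrend
import Mathlib.Analysis.SpecialFunctions.Pow.Real
import Literature.Computability.AlgebraicComplexity.MatMulMonomialSubrank
import HarnessLib

/-!
# `Q_M(⟨n,n,n⟩) ≥ n^{2-o(1)}` and `ω_M(⟨2,2,2⟩,⟨2⟩) ≤ 1/2` for monomial restriction (Behrend + Ruzsa–Szemerédi)

Topic `Literature/Computability/AlgebraicComplexity`; continuation of `MatMulMonomialSubrank.lean`.
PROVED asymptotic consequences of the Ruzsa–Szemerédi construction
(`tensorMonRestrictsTo_matMulTensor_unitTensor_of_threeAPFree`: a 3-AP-free `A ⊆ {0,…,q-1}` and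
`3q ≤ n` give `⟨n,n,n⟩ ≥_M ⟨q·|A|⟩`) fed with Behrend's lower bound for Roth numbers (Mathlib,
`Behrend.roth_lower_bound`: `N e^{-4√log N} ≤ r₃(N)`), in the form needed for the monomial
irreversibility barrier of Christandl–Vrana–Zuiddam (ToC 17 (2021) = arXiv:1812.06952, §2.4:
"`ω_M(⟨2,2,2⟩,⟨2⟩) = 1/2`", used in Thm. 13; `IrreversibilityBarrier.lean`).

## Content

* `exists_rpow_le_rothNumberNat` — for every `δ > 0`, `n^{1-δ} ≤ r₃(n)` for all large `n`
  (from Behrend: `e^{-4√log n} ≥ n^{-δ}` once `log n ≥ 16/δ²`).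
* `exists_tensorMonRestrictsTo_matMulTensor_unitTensor` — for `0 < ε ≤ 1` and all large `n` there
  is `R ≥ n^{2-ε}` with `⟨n,n,n⟩ ≥_M ⟨R⟩` (monomial subrank of matrix multiplication is
  `n^{2-o(1)}`).
* `exists_tensorMonRestrictsTo_kroneckerPow_matMulTensor_unitTensor` — for `0 < ε ≤ 1` and all
  large `L` there is `r ≥ (2-ε)L` with `⟨2,2,2⟩^{⊗L} ≥_M ⟨2⟩^{⊗r}`; this is the witness form of
  `ω_M(⟨2,2,2⟩,⟨2⟩) ≤ 1/2` for the infimum formalisation `monRelativeExponent` of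
  `RelativeExponent.lean` (the converse inequality, `≥ 1/2`, is the trivial flattening bound and is
  not needed for the barrier).

## Remarks

See the module docstring of `MatMulMonomialSubrank.lean`: for monomial RESTRICTION (generalised
sub-permutation matrices) the value `ω_M(⟨2,2,2⟩,⟨2⟩) = 1/2` is a Ruzsa–Szemerédi/Behrend
statement, not Strassen's `⌈3n²/4⌉` degeneration; the constants below (`16/δ²`, `16^{2/ε}`,
`2/ε`) are crude and chosen for short proofs.
-/

noncomputable section

open scoped BigOperators

namespace Literature.Computability.AlgebraicComplexity

universe u

/-! ## Behrend in exponent form -/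

section Behrend

/-- **Behrend's bound in exponent form**: for every `δ > 0`, `n^{1-δ} ≤ r₃(n) = rothNumberNat n`
for all `n ≥ ⌈e^{16/δ²}⌉` (then `4√(log n) ≤ δ log n`, so `n e^{-4√log n} ≥ n · n^{-δ}`; Behrend
1946 via Mathlib's `Behrend.roth_lower_bound`). [folklore] -/
theorem exists_rpow_le_rothNumberNat {δ : ℝ} (hδ : 0 < δ) :
    ∃ n₀ : ℕ, ∀ n ≥ n₀, (n : ℝ) ^ (1 - δ) ≤ rothNumberNat n := by
  refine ⟨⌈Real.exp (16 / δ ^ 2)⌉₊, fun n hn => ?_⟩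
  have hexp : Real.exp (16 / δ ^ 2) ≤ n := (Nat.le_ceil _).trans (by exact_mod_cast hn)
  have h1exp : (1 : ℝ) < Real.exp (16 / δ ^ 2) := by
    have := Real.add_one_le_exp (16 / δ ^ 2)
    have : (0 : ℝ) < 16 / δ ^ 2 := by positivity
    linarith
  have hnpos : (0 : ℝ) < n := by linarith
  have hlog : 16 / δ ^ 2 ≤ Real.log n := by
    rw [Real.le_log_iff_exp_le hnpos]
    exact hexp
  have hL : 0 ≤ Real.log n := le_trans (by positivity) hlog
  have h16 : 16 ≤ Real.log n * δ ^ 2 := by rwa [div_le_iff₀ (by positivity)] at hlog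
  -- `4 √(log n) ≤ δ log n`
  have hsq : 4 * Real.sqrt (Real.log n) ≤ δ * Real.log n := by
    have e1 : 4 * Real.sqrt (Real.log n) = Real.sqrt (16 * Real.log n) := by
      rw [Real.sqrt_mul (by norm_num) (Real.log n), show (16 : ℝ) = 4 ^ 2 by norm_num,
        Real.sqrt_sq (by norm_num)]
    have e2 : δ * Real.log n = Real.sqrt ((δ * Real.log n) ^ 2) :=
      (Real.sqrt_sq (by positivity)).symm
    rw [e1, e2]
    refine Real.sqrt_le_sqrt ?_
    nlinarith [mul_le_mul_of_nonneg_left h16 hL]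
  -- hence `n^{-δ} ≤ e^{-4 √(log n)}`
  have hnegδ : (n : ℝ) ^ (-δ) ≤ Real.exp (-4 * Real.sqrt (Real.log n)) := by
    rw [Real.rpow_def_of_pos hnpos, Real.exp_le_exp]
    linarith
  calc (n : ℝ) ^ (1 - δ) = (n : ℝ) * (n : ℝ) ^ (-δ) := by
        rw [sub_eq_add_neg, Real.rpow_add hnpos, Real.rpow_one]
    _ ≤ (n : ℝ) * Real.exp (-4 * Real.sqrt (Real.log n)) :=
        mul_le_mul_of_nonneg_left hnegδ hnpos.le
    _ ≤ rothNumberNat n := Behrend.roth_lower_bound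

end Behrend

/-! ## Monomial subrank of `⟨n,n,n⟩` and the relative exponent `ω_M(⟨2,2,2⟩,⟨2⟩)` -/

section MatMul

variable (K : Type u) [CommSemiring K]

/-- **`Q_M(⟨n,n,n⟩) ≥ n^{2-ε}` eventually**: for `0 < ε ≤ 1` and all large `n` there is `R` with
`n^{2-ε} ≤ R` and a MONOMIAL restriction `⟨n,n,n⟩ ≥_M ⟨R⟩` — the Ruzsa–Szemerédi construction in
`⟨n,n,n⟩` on `q = ⌊n/3⌋` with a 3-AP-free set of size `r₃(q) ≥ q^{1-ε/2}` (Behrend), so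
`R = q · r₃(q) ≥ q^{2-ε/2} ≥ (n/4)^{2-ε/2} ≥ n^{2-ε}` once `n^{ε/2} ≥ 16`. [folklore] -/
theorem exists_tensorMonRestrictsTo_matMulTensor_unitTensor {ε : ℝ} (hε : 0 < ε) (hε1 : ε ≤ 1) :
    ∃ n₀ : ℕ, ∀ n ≥ n₀, ∃ R : ℕ, (n : ℝ) ^ (2 - ε) ≤ R ∧
      TensorMonRestrictsTo (matMulTensor K n n n) (unitTensor K R) := by
  obtain ⟨n₁, hn₁⟩ := exists_rpow_le_rothNumberNat (half_pos hε)
  refine ⟨max (max 8 (3 * n₁)) ⌈(16 : ℝ) ^ (2 / ε)⌉₊, fun n hn => ?_⟩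
  have h8 : 8 ≤ n := le_trans (le_trans (le_max_left _ _) (le_max_left _ _)) hn
  have h3n₁ : 3 * n₁ ≤ n := le_trans (le_trans (le_max_right _ _) (le_max_left _ _)) hn
  have h16 : (16 : ℝ) ^ (2 / ε) ≤ n :=
    (Nat.le_ceil _).trans (by exact_mod_cast le_trans (le_max_right _ _) hn)
  -- the Ruzsa–Szemerédi configuration on `q = ⌊n/3⌋`
  obtain ⟨A, hA, hcard, h3⟩ := rothNumberNat_spec (n / 3)
  have hq3 : 3 * (n / 3) ≤ n := Nat.mul_div_le n 3
  have hq₁ : n₁ ≤ n / 3 := (Nat.le_div_iff_mul_le (by norm_num)).2 (by omega)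
  refine ⟨n / 3 * A.card, ?_, tensorMonRestrictsTo_matMulTensor_unitTensor_of_threeAPFree K hq3 hA h3⟩
  -- numerics
  have hnpos : (0 : ℝ) < n := by exact_mod_cast (show 0 < n by omega)
  have hq4 : n ≤ 4 * (n / 3) := by omega
  have hq4' : (n : ℝ) / 4 ≤ (n / 3 : ℕ) := by
    rw [div_le_iff₀ (by norm_num : (0 : ℝ) < 4)]
    exact_mod_cast (show n ≤ n / 3 * 4 by omega)
  have hqpos : (0 : ℝ) < (n / 3 : ℕ) := by exact_mod_cast (show 0 < n / 3 by omega)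
  have hρ : ((n / 3 : ℕ) : ℝ) ^ (1 - ε / 2) ≤ A.card := by
    rw [hcard]
    exact hn₁ (n / 3) hq₁
  -- `R ≥ q^{2 - ε/2}`
  have hR1 : ((n / 3 : ℕ) : ℝ) ^ (2 - ε / 2) ≤ ((n / 3 * A.card : ℕ) : ℝ) := by
    rw [show (2 : ℝ) - ε / 2 = 1 + (1 - ε / 2) by ring, Real.rpow_add hqpos, Real.rpow_one,
      Nat.cast_mul]
    exact mul_le_mul_of_nonneg_left hρ hqpos.le
  -- `q^{2-ε/2} ≥ (n/4)^{2-ε/2} = n^{2-ε/2}/4^{2-ε/2} ≥ n^{2-ε/2}/16`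
  have hexp0 : (0 : ℝ) ≤ 2 - ε / 2 := by linarith
  have hR2 : (n : ℝ) ^ (2 - ε / 2) / 16 ≤ ((n / 3 : ℕ) : ℝ) ^ (2 - ε / 2) := by
    have h1 : ((n : ℝ) / 4) ^ (2 - ε / 2) ≤ ((n / 3 : ℕ) : ℝ) ^ (2 - ε / 2) :=
      Real.rpow_le_rpow (by positivity) hq4' hexp0
    rw [Real.div_rpow hnpos.le (by norm_num) (2 - ε / 2)] at h1
    have h4 : (4 : ℝ) ^ (2 - ε / 2) ≤ 16 := by
      calc (4 : ℝ) ^ (2 - ε / 2) ≤ (4 : ℝ) ^ (2 : ℝ) :=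
            Real.rpow_le_rpow_of_exponent_le (by norm_num) (by linarith)
        _ = 16 := by norm_num
    have h4pos : (0 : ℝ) < (4 : ℝ) ^ (2 - ε / 2) := by positivity
    exact le_trans (div_le_div_of_nonneg_left (by positivity) h4pos h4) h1
  -- `n^{2-ε} · 16 ≤ n^{2-ε/2}` since `16 ≤ n^{ε/2}`
  have hR3 : (n : ℝ) ^ (2 - ε) ≤ (n : ℝ) ^ (2 - ε / 2) / 16 := by
    have h16' : (16 : ℝ) ≤ (n : ℝ) ^ (ε / 2) := by
      have h := Real.rpow_le_rpow (by positivity) h16 (le_of_lt (half_pos hε))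
      rwa [← Real.rpow_mul (by norm_num), show 2 / ε * (ε / 2) = (1 : ℝ) by field_simp,
        Real.rpow_one] at h
    rw [le_div_iff₀ (by norm_num : (0 : ℝ) < 16),
      show (2 : ℝ) - ε / 2 = (2 - ε) + ε / 2 by ring, Real.rpow_add hnpos]
    exact mul_le_mul_of_nonneg_left h16' (by positivity)
  exact hR3.trans (hR2.trans hR1)

/-- **`ω_M(⟨2,2,2⟩, ⟨2⟩) ≤ 1/2` in witness form**: for `0 < ε ≤ 1` and all large `L` there is
`r ≥ (2-ε)L` with a MONOMIAL restriction `⟨2,2,2⟩^{⊗L} ≥_M ⟨2⟩^{⊗r}`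
(`⟨2,2,2⟩^{⊗L} ≥_M ⟨2^L,2^L,2^L⟩ ≥_M ⟨R⟩ ≥_M ⟨2^{⌊log₂ R⌋}⟩ ≥_M ⟨2⟩^{⊗⌊log₂ R⌋}` with
`R ≥ (2^L)^{2-ε/2}`). CVZ §2.4 state `ω_M(⟨2,2,2⟩,⟨2⟩) = 1/2`; for monomial restriction the
inequality `≤` is this Behrend/Ruzsa–Szemerédi bound. [cite: ChristandlVranaZuiddam2021, §2.4] -/
theorem exists_tensorMonRestrictsTo_kroneckerPow_matMulTensor_unitTensor {ε : ℝ} (hε : 0 < ε)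
    (hε1 : ε ≤ 1) :
    ∃ L₀ : ℕ, ∀ L ≥ L₀, ∃ r : ℕ, (2 - ε) * L ≤ r ∧
      TensorMonRestrictsTo (kroneckerPow (matMulTensor K 2 2 2) L)
        (kroneckerPow (unitTensor K 2) r) := by
  obtain ⟨n₀, hn₀⟩ := exists_tensorMonRestrictsTo_matMulTensor_unitTensor K (half_pos hε)
    (by linarith)
  refine ⟨max n₀ ⌈2 / ε⌉₊, fun L hL => ?_⟩
  have hLn₀ : n₀ ≤ 2 ^ L := le_trans (le_trans (le_max_left _ _) hL) (Nat.lt_two_pow_self).le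
  have hLε : 2 / ε ≤ L := (Nat.le_ceil _).trans (by exact_mod_cast le_trans (le_max_right _ _) hL)
  obtain ⟨R, hR, hRS⟩ := hn₀ (2 ^ L) hLn₀
  -- `R ≠ 0`
  have hRpos : (0 : ℝ) < R := lt_of_lt_of_le (by positivity) hR
  have hR0 : R ≠ 0 := by
    rintro rfl
    simp at hRpos
  -- `2^r ≤ R < 2^(r+1)` for `r = ⌊log₂ R⌋`
  set r := Nat.log 2 R with hr
  have h2r : 2 ^ r ≤ R := Nat.pow_log_le_self 2 hR0
  have hR2 : R < 2 ^ (r + 1) := Nat.lt_pow_succ_log_self one_lt_two R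
  refine ⟨r, ?_, ((tensorMonRestrictsTo_kroneckerPow_matMulTensor K 2 2 2 L).trans hRS).trans
    (tensorMonRestrictsTo_unitTensor_kroneckerPow_unitTensor K h2r)⟩
  -- exponent count: `2^{L(2-ε/2)} ≤ R < 2^{r+1}`
  have hlow : (2 : ℝ) ^ ((L : ℝ) * (2 - ε / 2)) ≤ R := by
    rw [Real.rpow_mul (by norm_num), Real.rpow_natCast]
    exact_mod_cast hR
  have hup : (R : ℝ) < (2 : ℝ) ^ (((r + 1 : ℕ) : ℝ)) := by
    rw [Real.rpow_natCast]
    exact_mod_cast hR2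
  have hlt : (L : ℝ) * (2 - ε / 2) < ((r + 1 : ℕ) : ℝ) :=
    (Real.rpow_lt_rpow_left_iff one_lt_two).1 (hlow.trans_lt hup)
  push_cast at hlt
  -- `(2-ε) L ≤ L(2-ε/2) - 1` as `ε L / 2 ≥ 1`
  have hL1 : 1 ≤ ε * L / 2 := by
    rw [div_le_iff₀ hε] at hLε
    linarith
  linarith

end MatMul

end Literature.Computability.AlgebraicComplexity

end
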